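import Summits.Ventures.LatticeQCDFlow.Exactness.IMHAnyStartPathSplit
import Summits.Ventures.LatticeQCDFlow.Exactness.IMHAnyStartBurnIn
import HarnessLib

/-!
# Every start: SLIDING-WINDOW STATISTICS of flow-MCMC — the average of any bounded path statistic over the windows
# `[b+i, ∞)`, `i < M`, is within `r^b·(S_M/M) × its range` of its equilibrium mean, from every initial law

HONEST FRAMING: exact (Metropolis-corrected) sampling algorithms for lattice gauge theory;
figures of merit are autocorrelation/cost numbers at stated couplings and volumes; no
continuum-physics claim.

Venture `LatticeQCDFlow` (cell pub-lqcd), topic `Exactness`; FANOUT row 30 (lean-1, GEN-34).  NEW WORK of the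
cell, general state space.  `K = indepMH q w`, `x₀` a mode of the normalised weight, `r = 1 − 1/w(x₀)`,
`S_M = Σ_{i<M} r^i = w(x₀)(1 − r^M)`; path space = Mathlib `Kernel.trajMeasure`, `θ_t` the shift.  A practitioner's
estimator is typically a SLIDING-WINDOW AVERAGE `(1/M) Σ_{i<M} h(θ_{b+i} X)` of a bounded path statistic `h` — the
lag-`u` products `h(x) = f(x_0)g(x_u)` of the autocovariance ∕ `τ_int` estimators, running acceptance indicators
`1{x_1 ≠ x_0}`, windowed extrema …; `IMHAnyStartBurnIn` (this generation) treated `h(x) = f(x_0)`.  By the any-start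
path law (`IMHAnyStartPathSplit.imh_chain_shift_integral_anyStart_mem_Icc`: the window starting at `b + i` costs
`r^{b+i}`) and linearity:

* **`imh_chain_slidingAverage_anyStart_mem_Icc`** — for every initial law `μ₀`, every measurable path statistic
  `a ≤ h ≤ c`, every `b` and `M ≥ 1`:
  `E_{μ₀}[(1/M)Σ_{i<M} h(θ_{b+i}X)] − E_π[h] ∈ [(a − E_π h)·r^b·S_M/M, (c − E_π h)·r^b·S_M/M]`;
* **`imh_chain_slidingAverage_anyStart_abs_le`** — `|…| ≤ max(E_π h − a, c − E_π h)·r^b·min(1, w(x₀)/M)`: the start-up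
  bias of every sliding-window estimator decays like `w(x₀)/M = 1/(M·A)` times `r^b`, from every start (GEN-32's
  exact cold-start law for lag products, `…AutocovBias`, is the modal instance);
* **`imh_chain_slidingAverage_anyStart_abs_le_of_log_le`** — `log(1/ε) ≤ b/w(x₀)` ⇒ `≤ ε·max(E_π h − a, c − E_π h)`.

Reading (gauge files `Scaling/AutoregressiveGauge…AnyStartWindowStatistic`): the measured lag-`u` autocovariance,
the measured move fraction, any windowed statistic of an exact gauge sampler started anywhere is biased by at most
its range times `(1 − A)^b·min(1, 1/(M·A))`.  NOT CLAIMED: the variance of such estimators; empirically CENTRED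
statistics (they are not sliding averages of a fixed `h`; GEN-33 `IMHColdStartEmpiricalAutocov` for the cold start).

No `sorry`, no new definitions, nothing cited as a fact; general measurable space.
-/

noncomputable section

namespace Summit.Ventures.LatticeQCDFlow.Exactness

open MeasureTheory ProbabilityTheory Function Finset
open scoped ENNReal
open Summit.Ventures.LatticeQCDFlow.Scoring

variable {Ω : Type*} [MeasurableSpace Ω] {q : Measure Ω} [IsProbabilityMeasure q] {w : Ω → ℝ}

/-- **The expected sliding average is the average of the shifted expectations** (any probability law on paths):
`E[(1/M)Σ_{i<M} h(θ_{b+i}X)] = (1/M)Σ_{i<M} E[h(θ_{b+i}X)]`. [ours, bookkeeping] -/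
theorem integral_slidingAverage_eq (P : Measure (ℕ → Ω)) [IsProbabilityMeasure P] {h : (ℕ → Ω) → ℝ}
    (hh : Measurable h) {C : ℝ} (hC : ∀ x, |h x| ≤ C) (b M : ℕ) :
    ∫ x, (∑ i ∈ range M, h (fun n => x (b + i + n))) / M ∂P =
      (∑ i ∈ range M, ∫ x, h (fun n => x (b + i + n)) ∂P) / M := by
  have hΘ : ∀ i, Measurable (fun (x : ℕ → Ω) (n : ℕ) => x (b + i + n)) := fun i =>
    measurable_pi_lambda _ fun n => measurable_pi_apply _
  have hint : ∀ i, Integrable (fun x : ℕ → Ω => h (fun n => x (b + i + n))) P := fun i =>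
    integrable_of_bounded P (hh.comp (hΘ i)) fun x => hC _
  rw [integral_div, integral_finsetSum _ fun i _ => hint i]

/-- **SLIDING-WINDOW STATISTICS FROM EVERY START**: for every initial law `μ₀`, measurable `h` with `a ≤ h ≤ c`, every
`b` and `M ≥ 1`: `E_{μ₀}[(1/M)Σ_{i<M} h(θ_{b+i}X)] − E_π[h] ∈ [(a − E_π h)·r^b·S_M/M, (c − E_π h)·r^b·S_M/M]`. [ours] -/
theorem imh_chain_slidingAverage_anyStart_mem_Icc [Fact (Measurable w)] (hw0 : ∀ y, 0 < w y) {x₀ : Ω}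
    (hmax : ∀ y, w y ≤ w x₀) [IsProbabilityMeasure (q.withDensity fun y => ENNReal.ofReal (w y))]
    (μ₀ : Measure Ω) [IsProbabilityMeasure μ₀] {h : (ℕ → Ω) → ℝ} (hh : Measurable h) {a c : ℝ}
    (ha : ∀ x, a ≤ h x) (hc : ∀ x, h x ≤ c) (b : ℕ) {M : ℕ} (hM : M ≠ 0) :
    ∫ x, (∑ i ∈ range M, h (fun n => x (b + i + n))) / M ∂(Kernel.trajMeasure (X := fun _ : ℕ => Ω) μ₀
        (fun n : ℕ => (indepMH q w).comap (fun g : (i : ↥(Finset.Iic n)) → Ω => g ⟨n, Finset.mem_Iic.2 le_rfl⟩)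
          (measurable_pi_apply _))) -
      ∫ x, h x ∂(Kernel.trajMeasure (X := fun _ : ℕ => Ω) (q.withDensity fun y => ENNReal.ofReal (w y))
        (fun n : ℕ => (indepMH q w).comap (fun g : (i : ↥(Finset.Iic n)) → Ω => g ⟨n, Finset.mem_Iic.2 le_rfl⟩)
          (measurable_pi_apply _))) ∈
      Set.Icc
        ((a - ∫ x, h x ∂(Kernel.trajMeasure (X := fun _ : ℕ => Ω) (q.withDensity fun y => ENNReal.ofReal (w y))
            (fun n : ℕ => (indepMH q w).comap (fun g : (i : ↥(Finset.Iic n)) → Ω => g ⟨n, Finset.mem_Iic.2 le_rfl⟩)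
              (measurable_pi_apply _)))) * ((1 - (w x₀)⁻¹) ^ b * ∑ i ∈ range M, (1 - (w x₀)⁻¹) ^ i) / M)
        ((c - ∫ x, h x ∂(Kernel.trajMeasure (X := fun _ : ℕ => Ω) (q.withDensity fun y => ENNReal.ofReal (w y))
            (fun n : ℕ => (indepMH q w).comap (fun g : (i : ↥(Finset.Iic n)) → Ω => g ⟨n, Finset.mem_Iic.2 le_rfl⟩)
              (measurable_pi_apply _)))) * ((1 - (w x₀)⁻¹) ^ b * ∑ i ∈ range M, (1 - (w x₀)⁻¹) ^ i) / M) := by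
  set Pμ := Kernel.trajMeasure (X := fun _ : ℕ => Ω) μ₀
    (fun n : ℕ => (indepMH q w).comap (fun g : (i : ↥(Finset.Iic n)) → Ω => g ⟨n, Finset.mem_Iic.2 le_rfl⟩)
      (measurable_pi_apply _)) with hPμ
  set Pπ := Kernel.trajMeasure (X := fun _ : ℕ => Ω) (q.withDensity fun y => ENNReal.ofReal (w y))
    (fun n : ℕ => (indepMH q w).comap (fun g : (i : ↥(Finset.Iic n)) → Ω => g ⟨n, Finset.mem_Iic.2 le_rfl⟩)
      (measurable_pi_apply _)) with hPπ
  have hC : ∀ x, |h x| ≤ max |a| |c| := fun x => abs_le_max_abs_abs (ha x) (hc x)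
  have hMpos : (0 : ℝ) < M := by exact_mod_cast Nat.pos_of_ne_zero hM
  rw [integral_slidingAverage_eq Pμ hh hC b M]
  set m := ∫ x, h x ∂Pπ with hm
  -- each window: `E_{μ₀}[h(θ_{b+i}X)] − m ∈ r^{b+i}·[a − m, c − m]`
  have hwin : ∀ i, ∫ x, h (fun n => x (b + i + n)) ∂Pμ - m ∈
      Set.Icc ((1 - (w x₀)⁻¹) ^ (b + i) * (a - m)) ((1 - (w x₀)⁻¹) ^ (b + i) * (c - m)) := fun i =>
    imh_chain_shift_integral_anyStart_mem_Icc (q := q) hw0 hmax μ₀ hh ha hc (b + i)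
  have hlo : ∑ i ∈ range M, (1 - (w x₀)⁻¹) ^ (b + i) * (a - m) ≤ ∑ i ∈ range M, (∫ x, h (fun n => x (b + i + n)) ∂Pμ - m) :=
    sum_le_sum fun i _ => (hwin i).1
  have hhi : ∑ i ∈ range M, (∫ x, h (fun n => x (b + i + n)) ∂Pμ - m) ≤ ∑ i ∈ range M, (1 - (w x₀)⁻¹) ^ (b + i) * (c - m) :=
    sum_le_sum fun i _ => (hwin i).2
  rw [Finset.sum_sub_distrib, Finset.sum_const, Finset.card_range, nsmul_eq_mul] at hlo hhi
  have hgeom : ∀ d : ℝ, ∑ i ∈ range M, (1 - (w x₀)⁻¹) ^ (b + i) * d =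
      d * ((1 - (w x₀)⁻¹) ^ b * ∑ i ∈ range M, (1 - (w x₀)⁻¹) ^ i) := fun d => by
    rw [mul_sum, mul_sum]; refine sum_congr rfl fun i _ => ?_; rw [pow_add]; ring
  rw [hgeom] at hlo hhi
  set S := ∑ i ∈ range M, ∫ x, h (fun n => x (b + i + n)) ∂Pμ
  have hkey : S / M - m = (S - M * m) / M := by field_simp
  rw [hkey]
  constructor
  · rw [div_le_div_iff_of_pos_right hMpos]; linarith
  · rw [div_le_div_iff_of_pos_right hMpos]; linarith

/-- **`|E_{μ₀}[sliding average] − E_π[h]| ≤ max(E_π h − a, c − E_π h)·r^b·min(1, w(x₀)/M)`** from every start (`M ≥ 1`).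
[ours] -/
theorem imh_chain_slidingAverage_anyStart_abs_le [Fact (Measurable w)] (hw0 : ∀ y, 0 < w y) {x₀ : Ω}
    (hmax : ∀ y, w y ≤ w x₀) [IsProbabilityMeasure (q.withDensity fun y => ENNReal.ofReal (w y))]
    (μ₀ : Measure Ω) [IsProbabilityMeasure μ₀] {h : (ℕ → Ω) → ℝ} (hh : Measurable h) {a c : ℝ}
    (ha : ∀ x, a ≤ h x) (hc : ∀ x, h x ≤ c) (b : ℕ) {M : ℕ} (hM : M ≠ 0) :
    |∫ x, (∑ i ∈ range M, h (fun n => x (b + i + n))) / M ∂(Kernel.trajMeasure (X := fun _ : ℕ => Ω) μ₀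
        (fun n : ℕ => (indepMH q w).comap (fun g : (i : ↥(Finset.Iic n)) → Ω => g ⟨n, Finset.mem_Iic.2 le_rfl⟩)
          (measurable_pi_apply _))) -
      ∫ x, h x ∂(Kernel.trajMeasure (X := fun _ : ℕ => Ω) (q.withDensity fun y => ENNReal.ofReal (w y))
        (fun n : ℕ => (indepMH q w).comap (fun g : (i : ↥(Finset.Iic n)) → Ω => g ⟨n, Finset.mem_Iic.2 le_rfl⟩)
          (measurable_pi_apply _)))| ≤
      max (∫ x, h x ∂(Kernel.trajMeasure (X := fun _ : ℕ => Ω) (q.withDensity fun y => ENNReal.ofReal (w y))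
            (fun n : ℕ => (indepMH q w).comap (fun g : (i : ↥(Finset.Iic n)) → Ω => g ⟨n, Finset.mem_Iic.2 le_rfl⟩)
              (measurable_pi_apply _))) - a)
          (c - ∫ x, h x ∂(Kernel.trajMeasure (X := fun _ : ℕ => Ω) (q.withDensity fun y => ENNReal.ofReal (w y))
            (fun n : ℕ => (indepMH q w).comap (fun g : (i : ↥(Finset.Iic n)) → Ω => g ⟨n, Finset.mem_Iic.2 le_rfl⟩)
              (measurable_pi_apply _)))) *
        ((1 - (w x₀)⁻¹) ^ b * min 1 (w x₀ / M)) := by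
  obtain ⟨h1, h2⟩ := imh_chain_slidingAverage_anyStart_mem_Icc (q := q) hw0 hmax μ₀ hh ha hc b hM
  set Pπ := Kernel.trajMeasure (X := fun _ : ℕ => Ω) (q.withDensity fun y => ENNReal.ofReal (w y))
    (fun n : ℕ => (indepMH q w).comap (fun g : (i : ↥(Finset.Iic n)) → Ω => g ⟨n, Finset.mem_Iic.2 le_rfl⟩)
      (measurable_pi_apply _)) with hPπ
  set m := ∫ x, h x ∂Pπ
  have hW : 1 ≤ w x₀ := one_le_of_mode (q := q) hmax
  have hr0 : 0 ≤ 1 - (w x₀)⁻¹ := sub_nonneg.2 (inv_le_one_of_one_le₀ hW)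
  have hMpos : (0 : ℝ) < M := by exact_mod_cast Nat.pos_of_ne_zero hM
  obtain ⟨hma, hmc⟩ := integral_mem_Icc_of_bounds Pπ hh ha hc
  have hS0 : 0 ≤ ((1 - (w x₀)⁻¹) ^ b * ∑ i ∈ range M, (1 - (w x₀)⁻¹) ^ i) / M :=
    div_nonneg (mul_nonneg (pow_nonneg hr0 b) (sum_nonneg fun i _ => pow_nonneg hr0 i)) hMpos.le
  -- `S_M/M ≤ min(1, w(x₀)/M)`
  have hSM : ((1 - (w x₀)⁻¹) ^ b * ∑ i ∈ range M, (1 - (w x₀)⁻¹) ^ i) / M ≤ (1 - (w x₀)⁻¹) ^ b * min 1 (w x₀ / M) := by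
    rw [mul_div_assoc]
    refine mul_le_mul_of_nonneg_left ?_ (pow_nonneg hr0 b)
    refine le_min ?_ ?_
    · rw [div_le_one hMpos]; exact geom_sum_mode_le_card (q := q) hw0 hmax M
    · exact div_le_div_of_nonneg_right (geom_sum_mode_le_weight (q := q) hw0 hmax M) hMpos.le
  have hmax0 : 0 ≤ max (m - a) (c - m) := le_max_of_le_left (sub_nonneg.2 hma)
  set T := ((1 - (w x₀)⁻¹) ^ b * ∑ i ∈ range M, (1 - (w x₀)⁻¹) ^ i) / (M : ℝ) with hT
  have hm1 := mul_le_mul_of_nonneg_right (le_max_left (m - a) (c - m)) hS0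
  have hm2 := mul_le_mul_of_nonneg_right (le_max_right (m - a) (c - m)) hS0
  have hm3 := mul_le_mul_of_nonneg_left hSM hmax0
  rw [mul_div_assoc] at h1 h2
  have e1 : (a - m) * T = -((m - a) * T) := by ring
  rw [abs_le]
  constructor <;> linarith

/-- **THE BURN-IN RULE FOR SLIDING-WINDOW STATISTICS, FROM EVERY START**: `log(1/ε) ≤ b/w(x₀)` ⇒
`|E_{μ₀}[sliding average] − E_π[h]| ≤ ε·max(E_π h − a, c − E_π h)` for every window count `M ≥ 1`. [ours] -/
theorem imh_chain_slidingAverage_anyStart_abs_le_of_log_le [Fact (Measurable w)] (hw0 : ∀ y, 0 < w y) {x₀ : Ω}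
    (hmax : ∀ y, w y ≤ w x₀) [IsProbabilityMeasure (q.withDensity fun y => ENNReal.ofReal (w y))]
    (μ₀ : Measure Ω) [IsProbabilityMeasure μ₀] {h : (ℕ → Ω) → ℝ} (hh : Measurable h) {a c : ℝ}
    (ha : ∀ x, a ≤ h x) (hc : ∀ x, h x ≤ c) {b M : ℕ} (hM : M ≠ 0) {ε : ℝ} (hε : 0 < ε)
    (hb : Real.log (1 / ε) ≤ b * (w x₀)⁻¹) :
    |∫ x, (∑ i ∈ range M, h (fun n => x (b + i + n))) / M ∂(Kernel.trajMeasure (X := fun _ : ℕ => Ω) μ₀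
        (fun n : ℕ => (indepMH q w).comap (fun g : (i : ↥(Finset.Iic n)) → Ω => g ⟨n, Finset.mem_Iic.2 le_rfl⟩)
          (measurable_pi_apply _))) -
      ∫ x, h x ∂(Kernel.trajMeasure (X := fun _ : ℕ => Ω) (q.withDensity fun y => ENNReal.ofReal (w y))
        (fun n : ℕ => (indepMH q w).comap (fun g : (i : ↥(Finset.Iic n)) → Ω => g ⟨n, Finset.mem_Iic.2 le_rfl⟩)
          (measurable_pi_apply _)))| ≤
      ε * max (∫ x, h x ∂(Kernel.trajMeasure (X := fun _ : ℕ => Ω) (q.withDensity fun y => ENNReal.ofReal (w y))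
            (fun n : ℕ => (indepMH q w).comap (fun g : (i : ↥(Finset.Iic n)) → Ω => g ⟨n, Finset.mem_Iic.2 le_rfl⟩)
              (measurable_pi_apply _))) - a)
          (c - ∫ x, h x ∂(Kernel.trajMeasure (X := fun _ : ℕ => Ω) (q.withDensity fun y => ENNReal.ofReal (w y))
            (fun n : ℕ => (indepMH q w).comap (fun g : (i : ↥(Finset.Iic n)) → Ω => g ⟨n, Finset.mem_Iic.2 le_rfl⟩)
              (measurable_pi_apply _)))) := by
  refine (imh_chain_slidingAverage_anyStart_abs_le (q := q) hw0 hmax μ₀ hh ha hc b hM).trans ?_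
  set Pπ := Kernel.trajMeasure (X := fun _ : ℕ => Ω) (q.withDensity fun y => ENNReal.ofReal (w y))
    (fun n : ℕ => (indepMH q w).comap (fun g : (i : ↥(Finset.Iic n)) → Ω => g ⟨n, Finset.mem_Iic.2 le_rfl⟩)
      (measurable_pi_apply _)) with hPπ
  obtain ⟨hma, hmc⟩ := integral_mem_Icc_of_bounds Pπ hh ha hc
  have hmax0 : 0 ≤ max (∫ x, h x ∂Pπ - a) (c - ∫ x, h x ∂Pπ) := le_max_of_le_left (sub_nonneg.2 hma)
  have hW : 1 ≤ w x₀ := one_le_of_mode (q := q) hmax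
  have hr0 : 0 ≤ 1 - (w x₀)⁻¹ := sub_nonneg.2 (inv_le_one_of_one_le₀ hW)
  have hpow := pow_mode_le_of_log_le (q := q) hmax hε hb
  have hmin1 : min 1 (w x₀ / M) ≤ 1 := min_le_left _ _
  have hmin0 : 0 ≤ min 1 (w x₀ / M) := le_min zero_le_one (div_nonneg (hw0 x₀).le (Nat.cast_nonneg M))
  calc _ ≤ max (∫ x, h x ∂Pπ - a) (c - ∫ x, h x ∂Pπ) * (ε * 1) := by
        refine mul_le_mul_of_nonneg_left ?_ hmax0
        exact mul_le_mul hpow hmin1 hmin0 hε.le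
    _ = _ := by ring

end Summit.Ventures.LatticeQCDFlow.Exactness

end
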